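import Summits.NavierStokesRegularity.NavierStokesRegularity.Cruxes.BoundedTemperatureClosed.SketchIdeator4
import Summits.NavierStokesRegularity.NavierStokesRegularity.Theorems.BoundedTemperatureClosed.Negative.H10DataBites
import Summits.NavierStokesRegularity.NavierStokesRegularity.Theorems.PumpContinuationBoundedTemperatureClosedDenseMeetsFiniteCodim

/-!
# Line `SketchIdeator4` — lead a1's kernel checks: where the two open stubs carry `¬H`

Companion of the registered skeleton `Lines/SketchIdeator4.lean` (stubs `stub_relaxedClosedH10 :
RelaxedClosedIn h10Data`, `stub_saturationOfDense : DenseMeetsFiniteCodim → SchwartzSaturationIn h10Data`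
open; `stub_schwartzSubH10` p161486 and `stub_denseMeetsFiniteCodim` p161715 LANDED). Everything here is a
definitional bridge from the ideator's vocabulary (`IdeasK4.btSetIn`, `h10Data`, `IsTypeIWitness`,
`RelaxedClosedIn`, `SchwartzSaturationIn`; Disproof's `NSTypeICeiling`, `TypeIInfimumNotAttainedNS`) to the
LANDED Negative-lane file `Theorems/BoundedTemperatureClosed/Negative/H10DataBites.lean` (p162218), so that
the following are kernel facts about the REGISTERED stub signatures:

* `h10Attain_of_stub_relaxedClosedH10` — `RelaxedClosedIn h10Data` ALONE proves attainment of the infimal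
  Type-I ceiling of Navier–Stokes over `H¹⁰_df` data (`∀ m > 0, (∀ M > m, NSTypeICeilingH10[M]) → NSTypeICeilingH10[m]`),
  plus an `H¹⁰_df` temperature floor (`h10Floor_of_stub_relaxedClosedH10`): the `H¹⁰_df` twin of `¬H`.
  The stub is the crux itself over a larger data class — crux-sized, not worker-sized.
* `exactReentry_of_schwartzSaturation` — `SchwartzSaturationIn h10Data` ALONE is exact Schwartz re-entry
  of Navier–Stokes Type-I blow-ups at every ceiling (`NSTypeICeilingH10[K] → NSTypeICeiling K`, Euler datum).
* `not_typeIInfimumNotAttainedNS_of_stubs`, `not_stubs_of_typeIInfimumNotAttainedNS` — jointly the two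
  stubs prove the crux (`IdeasK4.crux_of_relaxedH10` with the landed `stub_schwartzSubH10`) and hence
  `¬ TypeIInfimumNotAttainedNS`; `H` refutes their conjunction (Sketch-dead O1 located for this line),
  and under `H` + saturation the relaxed-closedness stub is FALSE (`not_relaxedClosed_of_H_of_saturation`).

No `sorry`; nothing here is a stub or closes anything.
-/

noncomputable section

open MeasureTheory Set Filter Topology
open scoped ENNReal
open Literature.Analysis.FluidPDE Literature.Analysis.FluidPDE.Tao2016
open Summit.NavierStokesRegularity.NavierStokesRegularity.Cruxes.BoundedTemperatureClosed.Disproof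
  (segForm btSet NSTypeICeiling TypeIInfimumNotAttainedNS crux_false_of_typeIInfimumNotAttainedNS)
open Summit.NavierStokesRegularity.NavierStokesRegularity.Cruxes.BoundedTemperatureClosed.IdeasK4

-- nested summit namespace is the tree layout (D-0017)
set_option linter.dupNamespace false

namespace Summit.NavierStokesRegularity.NavierStokesRegularity.Cruxes.BoundedTemperatureClosed.SketchIdeator4Checks

/-- Shorthand (notation for `∃ a, MemH10df a ∧ IsTypeIWitness eulerForm K a`): Navier–Stokes has an
`H¹⁰_df`-DATA `H¹⁰_df`-mild Type-I blow-up at ceiling `K` with no mild extension — the relaxed membership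
predicate at the Euler end. -/
local notation3 "NSTypeICeilingH10[" K "]" =>
  ∃ a : Literature.Analysis.FluidPDE.Tao2016.L2C, Literature.Analysis.FluidPDE.Tao2016.MemH10df a ∧
    Summit.NavierStokesRegularity.NavierStokesRegularity.Cruxes.BoundedTemperatureClosed.IdeasK4.IsTypeIWitness
      Literature.Analysis.FluidPDE.Tao2016.eulerForm K a

/-! ### Definitional bridges: the registered stub signatures ARE the Negative file's hypotheses -/

/-- The Disproof's open statement `H` is, definitionally, the registered one of the Negative lane (p146867). -/
theorem typeIInfimumNotAttainedNS_iff :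
    TypeIInfimumNotAttainedNS ↔ Theorems.BoundedTemperatureClosed.Negative.TypeIInfimumNotAttainedNS :=
  Iff.rfl

/-- `RelaxedClosedIn h10Data` is, definitionally, the hypothesis `relaxedClosedH10` of `H10DataBites`. -/
theorem relaxedClosedIn_h10Data_iff :
    RelaxedClosedIn h10Data ↔
      ∀ 𝒜 : AveragingDatum, 𝒜.IsSymmetric → 𝒜.HasCancellation → ∀ M : ℝ,
        IsClosed {θ : ℝ | θ ∈ Icc (0 : ℝ) 1 ∧ ∃ a : L2C, MemH10df a ∧ ∃ S : ℝ, 0 < S ∧ ∃ u : ℝ → L2C,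
          IsMildSolutionFor (fun a b c => ((1 - θ : ℝ) : ℂ) * 𝒜.form a b c + ((θ : ℝ) : ℂ) * eulerForm a b c)
            a (Ico 0 S) u ∧
          (∀ t ∈ Ico 0 S, eLpNorm (u t) ⊤ volume ≤ ENNReal.ofReal (M / Real.sqrt (S - t))) ∧
          ¬ ∃ S' : ℝ, S < S' ∧ ∃ v : ℝ → L2C,
            IsMildSolutionFor (fun a b c => ((1 - θ : ℝ) : ℂ) * 𝒜.form a b c + ((θ : ℝ) : ℂ) * eulerForm a b c)
              a (Ico 0 S') v ∧ ∀ t ∈ Ico 0 S, v t = u t} :=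
  Iff.rfl

/-- `SchwartzSaturationIn h10Data` is, definitionally, the hypothesis `schwartzSaturationH10` of `H10DataBites`. -/
theorem schwartzSaturationIn_h10Data_iff :
    SchwartzSaturationIn h10Data ↔
      ∀ 𝒜 : AveragingDatum, 𝒜.IsSymmetric → 𝒜.HasCancellation → ∀ M : ℝ,
        {θ : ℝ | θ ∈ Icc (0 : ℝ) 1 ∧ ∃ a : L2C, MemH10df a ∧ ∃ S : ℝ, 0 < S ∧ ∃ u : ℝ → L2C,
          IsMildSolutionFor (fun a b c => ((1 - θ : ℝ) : ℂ) * 𝒜.form a b c + ((θ : ℝ) : ℂ) * eulerForm a b c)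
            a (Ico 0 S) u ∧
          (∀ t ∈ Ico 0 S, eLpNorm (u t) ⊤ volume ≤ ENNReal.ofReal (M / Real.sqrt (S - t))) ∧
          ¬ ∃ S' : ℝ, S < S' ∧ ∃ v : ℝ → L2C,
            IsMildSolutionFor (fun a b c => ((1 - θ : ℝ) : ℂ) * 𝒜.form a b c + ((θ : ℝ) : ℂ) * eulerForm a b c)
              a (Ico 0 S') v ∧ ∀ t ∈ Ico 0 S, v t = u t} ⊆ btSet (segForm 𝒜) M :=
  Iff.rfl

/-! ### What each open stub carries -/

/-- **`stub_relaxedClosedH10` alone ⟹ `H¹⁰_df`-attainment of the infimal Type-I ceiling of Navier–Stokes**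
(landed `nsTypeIH10_of_forall_lt_of_relaxedClosedH10`, zero datum). -/
theorem h10Attain_of_stub_relaxedClosedH10 (hR : RelaxedClosedIn h10Data) {m : ℝ} (hm : 0 < m)
    (h : ∀ M : ℝ, m < M → NSTypeICeilingH10[M]) : NSTypeICeilingH10[m] :=
  Theorems.BoundedTemperatureClosed.Negative.nsTypeIH10_of_forall_lt_of_relaxedClosedH10 hR hm h

/-- **`stub_relaxedClosedH10` alone ⟹ an `H¹⁰_df` temperature floor for Navier–Stokes**
(landed `not_forall_pos_nsTypeIH10_of_relaxedClosedH10`). -/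
theorem h10Floor_of_stub_relaxedClosedH10 (hR : RelaxedClosedIn h10Data) :
    ¬ ∀ M : ℝ, 0 < M → NSTypeICeilingH10[M] :=
  Theorems.BoundedTemperatureClosed.Negative.not_forall_pos_nsTypeIH10_of_relaxedClosedH10 hR

/-- **`SchwartzSaturationIn h10Data` alone ⟹ exact Schwartz re-entry at every ceiling**
(landed `nsTypeI_of_nsTypeIH10_of_schwartzSaturationH10`, Euler datum). -/
theorem exactReentry_of_schwartzSaturation (hS : SchwartzSaturationIn h10Data) {K : ℝ}
    (h : NSTypeICeilingH10[K]) : NSTypeICeiling K :=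
  Theorems.BoundedTemperatureClosed.Negative.nsTypeI_of_nsTypeIH10_of_schwartzSaturationH10 hS h

/-- The saturation stub of the skeleton, fed with the LANDED dense-meets-finite-codimension brick (p161715),
is plain `SchwartzSaturationIn h10Data`: the brick is no longer a hypothesis. -/
theorem schwartzSaturation_of_stub
    (hsat : DenseMeetsFiniteCodim → SchwartzSaturationIn h10Data) : SchwartzSaturationIn h10Data :=
  hsat Theorems.PumpContinuationDenseMeetsFiniteCodim.stub_denseMeetsFiniteCodim

/-! ### Jointly: the crux, hence `¬H`; and `H` kills the conjunction -/

/-- **The two open stubs prove the crux** (the ideator's transfer with the landed Schwartz stub p161486). -/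
theorem crux_of_stubs (hR : RelaxedClosedIn h10Data)
    (hsat : DenseMeetsFiniteCodim → SchwartzSaturationIn h10Data) :
    Theses.PumpContinuation.BoundedTemperatureClosed :=
  crux_of_relaxedH10 (fun _ ⟨u₀, hdiv, ha⟩ => ha ▸
      Theorems.PumpContinuationSchwartzData.memH10df_schwartzL2 u₀ hdiv) hR
    (schwartzSaturation_of_stub hsat)

/-- **The two open stubs prove `¬ TypeIInfimumNotAttainedNS`** (attainment of the infimal Type-I ceiling of
Schwartz-data `H¹⁰_df`-mild Navier–Stokes blow-ups — the open statement that killed line `Sketch`). -/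
theorem not_typeIInfimumNotAttainedNS_of_stubs (hR : RelaxedClosedIn h10Data)
    (hsat : DenseMeetsFiniteCodim → SchwartzSaturationIn h10Data) : ¬ TypeIInfimumNotAttainedNS :=
  fun hH => crux_false_of_typeIInfimumNotAttainedNS hH (crux_of_stubs hR hsat)

/-- **`H` refutes the conjunction of the two open stubs** (Sketch-dead O1, located for this line). -/
theorem not_stubs_of_typeIInfimumNotAttainedNS (hH : TypeIInfimumNotAttainedNS) :
    ¬ (RelaxedClosedIn h10Data ∧ (DenseMeetsFiniteCodim → SchwartzSaturationIn h10Data)) :=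
  fun h => not_typeIInfimumNotAttainedNS_of_stubs h.1 h.2 hH

/-- **Under `H` and Schwartz saturation, `stub_relaxedClosedH10` is FALSE** (zero datum, ceiling `2K`). -/
theorem not_relaxedClosed_of_H_of_saturation (hH : TypeIInfimumNotAttainedNS)
    (hS : SchwartzSaturationIn h10Data) : ¬ RelaxedClosedIn h10Data :=
  Theorems.BoundedTemperatureClosed.Negative.not_relaxedClosedH10_of_schwartzSaturationH10_of_typeIInfimumNotAttainedNS
    hH hS

end Summit.NavierStokesRegularity.NavierStokesRegularity.Cruxes.BoundedTemperatureClosed.SketchIdeator4Checks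

end
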